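import Literature.MathematicalPhysics.QuantumFieldTheory.Balaban1983to89.B6Block112DictionaryV1

/-!
# `Balaban1983to89.B6Block112GEV1` — T. Bałaban, *Propagators and renormalization transformations for lattice gauge theories. II*,
# Commun. Math. Phys. **96** (1984) 223–250 [Balaban1984PropagatorsII], Prop. 2.5 p. 246 with [4] = *… I*, CMP **95** (1984) Prop. 1.2
# (1.112) p. 36: towards the member `|(∇G∇*J)(x)| ≤ O(1)e^{−δ₂|y−y′|}(‖J‖_ε + |J|)` for the two-scale `G` of (2.90) — the term
# `∇_μG^{(w′)}∇_λ*`: [4] (1.112) FOR `G_k` BY NAME transported to a CUBE-SUP BOUND WITH HÖLDER INPUT on the two-scale carriers, sources supported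
# over the unit sites within `r` of `y′` (r02's unit-scale partition) — file M1b of the (1.112)/(1.113) members (p38 gen 22); the (1.112) twin of
# p22's `B6BlockDecayGDivBridgeV1` / this seat's `B6BlockHolderGDivGEV1`

statement-level skeleton of published theorems with citation tags; proofs where landed; nothing here is a claim about the Yang–Mills mass gap

PDF held: `paper:balaban1984-cmp96-propagators-rt-ii` (journal page = PDF page + 222), p. 246 [PDF 24]; `paper:balaban1984-cmp95-propagators-rt-i` ([4],
journal page = PDF page + 16), p. 36 [PDF 20].  PRINT.  [4] p. 36 (verbatim, as quoted in the tree's `B5.Prop12Printed`): *"|(∇G∇*J)(x)| ≤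
O(1)e^{−δ₀|y−y′|}(‖J‖_ε + |J|) (1.112) for 0 < ε < 1, x ∈ Δ̃(y), supp J ⊂ Δ̃(y′), with the constant O(1) depending on d and ε (O(1) → ∞ if
ε → 0)"*; p. 36: *"The localized inequalities (1.110)–(1.114) imply immediately the following global inequalities"* [(1.115)–(1.117), among them
*"|∇G∇*J| ≤ O(1)(‖J‖_ε + |J|), (1.116)"*]; [B6] p. 246: *"From these representations we obtain all the necessary properties of the operators H_j,
G̃_j. They follow from the Proposition 1.2 …"*.

CITATION HEADER (lean-in-tree rule) — WHAT IS REPRODUCED.  Phase-2 file of the `lit-balaban` typed skeleton (HOME `run/shared/lean/pub/lit-balaban/`),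
seat **p38 gen 22** (B6 fold owner r03, referee ref-4; p22 g15 hand-off 2026-08-22T10:32Z of the (1.111)–(1.113) members), FILE M1b of the (1.112)/(1.113)
members of p22's Prop. 2.5 two-level decay programme for the genuine two-scale `G` of (2.90) (`…B6SectCTwoScaleV1Lattice.tsV1`, `Λ′` arbitrary,
`c = L^j`); SKELETON rows **B6.Prop2.5** / **B6.Eq2.131** and [4] **B5.Prop1.2** (cells only; decls of record untouched).  In the differentiated
representation (2.129), `∇_μG∇_λ* = (∇_μ∂H′_j)C(∇_λ∂H′_j)* + ∇_μG^{(w′)}∇_λ* − (∇_μH_j)(Q_jG^{(w′)}∇_λ*) + (∇_μH_j)C̃(∇_λH_j)* − (∇_μM)K₂∇_λ* −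
(∇_μK₂*)M∇_λ* + (∇_μK₂*)MK₂∇_λ*` (`M = G̃_j + H_jC̃H_j*`, `G̃_j = (I − H_jQ_j)G^{(w′)}`), every term but `∇_μG^{(w′)}∇_λ*` has a plain block bound
from landed factor bounds; the term `∇_μG^{(w′)}∇_λ*` is the only one that needs the Hölder norm `‖J‖_ε` of the source, and it is [4] (1.112)
FOR `G_k` BY NAME.  THIS FILE (on file M1a `…B6Block112DictionaryV1`: the member for `G_k` at all scales, the value and Hölder
dictionaries).  §4 THE PIECES: r02's unit-scale partition `T = Σ_z ζ′_zT` (`…B5GlobCoverP12Lattice.pieceL`, `sum_pieces_ten`, `piece_supp/sup/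
holder`: `supp ζ′_zT ⊂ Δ̃(z)`, `|ζ′_zT| ≤ |T|`, `‖ζ′_zT‖_ε ≤ c_P(‖T‖_ε + |T|)`, `c_P = max(1, Lw)`) — the printed «immediately» of p. 36, used here to
pass from `supp J ⊂ Δ̃(y′)` to sources supported over the unit sites within `r` of `y′` (p22's radius-`r` packaging of the (1.110) members):
`pieceL_srcT_eq` (a piece of the tensor source of `x` is the tensor source of `ζ′_z·x`), **`srcPiece_eq_zero_of_far`** (pieces centred farther
than `r + 3` from `y′` vanish: p19's `distSite_le_three_of_mem_mem`, `EK_mem_cubeT_blk`).  §5 **`abs_DGEDadj_apply_le`**: if (1.112) holds on B5's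
carrier of scale `j` at `(O(1)(ε), δ)`, then for `x` supported over the unit sites within `r` of `y′`, `|x| ≤ X`, Hölder quotients `≤ X_ε` (file
M1a §3), and every fine bond `b₀`: `|(∇_μG^{(w′)}∇_λ*x)(b₀)| ≤ O(1)(ε)·K(1)e^{(1+δ)(r+3)}·(c_P + 1)·e^{−δ|y(b₀₋) − y′|_T}·(X_ε + X)` — the value
is `Re` of the field of `T = Σ_z ζ′_zT` (linearity: r02's `grad_sum`, `divT_sum`), each piece is bounded by (1.112) at its centre `z`, the far pieces
vanish, the near ones are counted by p22's `card_ball_le` (`sum_ball_exp_le`).  §6 **`cubeSup112_DGEDadj_scaling`**: the same with ONE `δ > 0` (on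
`d, L, a`) and ONE `C_ε ≥ 0` per `ε`, for all volumes and all scales `j ≤ m + K` (file M1a §1).  IMPORTS BY NAME, restating nothing.  THEOREMS
ONLY (no `def`, no `def … : Prop`); standard axioms.  HONEST SCOPE / DIVERGENCES. (1) as file M1a: one `λ`, one `μ`, differences with the factor
`L^j`. (2) The constant `C_ε = O(1)(ε)·K(1)·(c_P + 1)` and the growth `e^{(1+δ)(r+3)}` are ours (print: `O(1)` depending on `d, ε`). (3) The Hölder
hypothesis on `x` is only used on pairs at distance `≤ L^j` (as (1.109)). (4) No new definition, no new hypothesis.  NOT summit progress.  Unit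
`lit-balaban-p38` (gen 22), 2026-08-22.
-/

noncomputable section

open scoped InnerProductSpace BigOperators Matrix
open Finset

namespace Literature.MathematicalPhysics.QuantumFieldTheory.Balaban1983to89.B6Block112GEV1

open LatticeFieldCalculus B5SectBStatements B5Eq117TorusCarriers B6SectADomainsV1 B6SectAOperatorsV1 B6SectAVectorModelV1 B6SectCOperators
  B6SectCTwoScaleV1 B6SectCTwoScaleV1Lattice B5Eq118OneStroke
open BalabanImbrieJaffe1984to88.BIJ85AxialPropagator411 (BondSpace)
open B4Sect5Torus (IsPseudoDist SumBound)
open B4TorusKernel.MultiPeriod (torusSupNorm torusSupNorm_nonneg)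
open B4Sect5Proof (latticeConst latticeConst_nonneg)
open B5Prop11Plancherel (Tor fine unitVec fdiff)
open B5Prop11Lower (nsq nsq_nonneg)
open B5Prop11Lattice (divT l2T)
open B5Prop11SettingModel (Loc189 locNorm)
open B5DeltaA169 (DeltaA)
open B5Prop12FieldsLattice (distSite distU cubeT cubeB suppInL supNormL holderL holderT e4L l2locL cutInL cutSupL smulT)
open B5SettingP12Real (LocR latticeSettingP12R)
open B5Prop12GLattice (famG)
open B5Local114GLattice (delta114 const114 delta114_pos const114_pos l2locL_le_printed)
open B5CoverP12Lattice (wP wP_nonneg wP_le_one wP_eq_zero_of_not_mem Lw Lw_nonneg)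
open B5GlobCoverP12Lattice (pieceL piece_supp piece_sup piece_holder sum_pieces_ten grad_sum divT_sum smulT_sum)
open B5RowSumsP12Lattice (distSite_triangle distSite_comm)
open B6LowerBound2153Torus (rep)
open B3TorusRadialSums (supDist_comm)
open B6BlockDecayCalculus (torusDist_isPseudoDist torusDist_sumBound card_ball_le)
open B6BlockDecayHprimeCovV1 (supDist_cast_eq_torusSupNorm)
open B6BlockDecayGradFactorsV1 (Dop_comp_apply)
open B6BlockHolderGDivGEV1 (GE_Dadj_apply_eq suppInL_srcT supNormL_srcT_le)
open BalabanImbrieJaffe1984to88.BIJ85Thm711TorusTransport (EK_shift)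
open BalabanImbrieJaffe1984to88.BIJ85Prop12BridgeGeometry (supDist_cast_eq_distSite EK_mem_cubeT_blk distU_EK distSite_le_three_of_mem_mem two_le_Mk)
open BalabanImbrieJaffe1984to88.BIJ85Prop12BridgeZero (indCut cutInL_indCut indCut_of_mem cutSupL_indCut_le locNorm_le_supNormL constZero
  constZero_nonneg)
open BalabanImbrieJaffe1984to88.BIJ85Prop12AllTori (famG_reindex)
open B6Block112DictionaryV1 (e4L_allScales DGEDadj_apply_eq holderL_srcT_le)
open LatticeNorms (supNorm norm_le_supNorm supNorm_le supNorm_nonneg holderSeminorm holderSeminormB5 holderSeminorm_le holderSeminorm_nonneg)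

section Transport

variable {d L m K : ℕ} [NeZero L] {hd : 1 ≤ d + 1} {hL : Odd L ∧ 1 < L} {j : ℕ}
  (hj' : j ≤ (⟨d + 1, L, m, K, hd, hL⟩ : Params).m + (⟨d + 1, L, m, K, hd, hL⟩ : Params).K)
  (hc : ((L : ℝ) ^ j) ≠ 0) {a : ℝ} (ha : 0 < a) (hw' : (0 : ℝ) < a * ((L : ℝ) ^ j) ^ (d + 1))

/-! ## §4  The pieces `ζ′_zT` of the tensor source and their vanishing far from the support -/

/-- `A(Σ_i v_i) = Σ_i Av_i` (matrix action on a finite sum of vectors). [cite: Balaban1984PropagatorsI, (1.89) p.33 (linearity of G; bookkeeping ours)] -/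
private theorem mulVec_finset_sum' {ι₁ ι₂ : Type*} [Fintype ι₁] [Fintype ι₂] {κ : Type*} (A : Matrix ι₂ ι₁ ℂ) (s : Finset κ)
    (v : κ → ι₁ → ℂ) : A *ᵥ (∑ i ∈ s, v i) = ∑ i ∈ s, A *ᵥ v i := by
  have h := map_sum (Matrix.mulVecLin A) v s
  simp only [Matrix.mulVecLin_apply] at h
  exact h

/-- `∇(Δ_a⁻¹∇*0) = 0`. [cite: Balaban1984PropagatorsI, (1.89) p.33 (linearity; bookkeeping ours)] -/
private theorem grad_G_divT_zero {n : ℕ} [NeZero n] {M : Fin (d + 1) → ℕ} [∀ μ, NeZero (M μ)] (A : Matrix (Tor (fine n M) × Fin (d + 1)) (Tor (fine n M) × Fin (d + 1)) ℂ) :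
    B5Prop11Lattice.grad n M (A *ᵥ divT n M (0 : Fin (d + 1) → (Tor (fine n M) × Fin (d + 1) → ℂ))) = 0 := by
  have h0 : divT n M (0 : Fin (d + 1) → (Tor (fine n M) × Fin (d + 1) → ℂ)) = 0 := by
    unfold divT
    exact Finset.sum_eq_zero fun ν _ => by rw [Pi.zero_apply, Matrix.mulVec_zero]
  rw [h0, Matrix.mulVec_zero]
  funext ν
  unfold B5Prop11Lattice.grad
  rw [Matrix.mulVec_zero]
  rfl

omit [NeZero L] in
/-- **the piece `ζ′_zT` of the tensor source is again the embedding of a real tensor source** (`ζ′_z = wP z` is real):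
`pieceL z T^c = (wP z · T)^c`. [cite: Balaban1984PropagatorsI, (1.115)–(1.117) p.36 (decomposition of J over the cubes Δ̃(z))] -/
theorem pieceL_srcT_eq (lam : Fin (d + 1)) (x : BondSpace (⟨d + 1, L, m, K, hd, hL⟩ : Params)) (z : Site (⟨d + 1, L, m, K, hd, hL⟩ : Params) j) :
    pieceL (Mk (⟨d + 1, L, m, K, hd, hL⟩ : Params) j) (L ^ j) z
        (LocR.ten (fun ν b => if ν = lam then x ⟨(EK hj').symm b.1, b.2⟩ else 0) : LocR (L ^ j) (Mk (⟨d + 1, L, m, K, hd, hL⟩ : Params) j)).emb =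
      (LocR.ten (fun ν b => wP (Mk (⟨d + 1, L, m, K, hd, hL⟩ : Params) j) (L ^ j) z b.1 * (if ν = lam then x ⟨(EK hj').symm b.1, b.2⟩ else 0)) :
        LocR (L ^ j) (Mk (⟨d + 1, L, m, K, hd, hL⟩ : Params) j)).emb := by
  show Loc189.ten (smulT (L ^ j) (Mk (⟨d + 1, L, m, K, hd, hL⟩ : Params) j) (wP (Mk (⟨d + 1, L, m, K, hd, hL⟩ : Params) j) (L ^ j) z)
      (fun ν b => ((if ν = lam then x ⟨(EK hj').symm b.1, b.2⟩ else 0 : ℝ) : ℂ))) =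
    Loc189.ten (fun ν b => ((wP (Mk (⟨d + 1, L, m, K, hd, hL⟩ : Params) j) (L ^ j) z b.1 * (if ν = lam then x ⟨(EK hj').symm b.1, b.2⟩ else 0) : ℝ) : ℂ))
  congr 1
  funext ν b
  simp only [smulT, Complex.ofReal_mul]

/-- **pieces centred far from the support vanish**: if `x` is supported over the unit sites within `r` of `y′` (`|y(b₋) − y′|_T ≤ r` whenever
`x(b) ≠ 0`), then for every unit site `z` with `|z − y′|_T > r + 3` the piece `ζ′_zT` of the tensor source is `0` — a fine site in `supp ζ′_z ⊂ Δ̃(z)`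
and in the block `B(y(b₋)) ⊂ Δ̃(y(b₋))` forces `|z − y(b₋)| ≤ 3` (p19's `distSite_le_three_of_mem_mem`, `EK_mem_cubeT_blk`).
[cite: Balaban1984PropagatorsI, Prop. 1.2 p.35 («supp J ⊂ Δ̃(y′)»), (1.115)–(1.117) p.36] -/
theorem srcPiece_eq_zero_of_far (lam : Fin (d + 1)) (x : BondSpace (⟨d + 1, L, m, K, hd, hL⟩ : Params)) {r : ℝ} (y' : Site (⟨d + 1, L, m, K, hd, hL⟩ : Params) j)
    (hsupp : ∀ b : PBond (⟨d + 1, L, m, K, hd, hL⟩ : Params) 0, x b ≠ 0 →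
      torusSupNorm (Mk (⟨d + 1, L, m, K, hd, hL⟩ : Params) j) (rep (Mk (⟨d + 1, L, m, K, hd, hL⟩ : Params) j) (iterBlockOf j b.src) - rep (Mk (⟨d + 1, L, m, K, hd, hL⟩ : Params) j) y') ≤ r)
    (z : Site (⟨d + 1, L, m, K, hd, hL⟩ : Params) j)
    (hz : ¬ torusSupNorm (Mk (⟨d + 1, L, m, K, hd, hL⟩ : Params) j) (rep (Mk (⟨d + 1, L, m, K, hd, hL⟩ : Params) j) z - rep (Mk (⟨d + 1, L, m, K, hd, hL⟩ : Params) j) y') ≤ r + 3) :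
    (fun ν (b : Tor (fine (L ^ j) (Mk (⟨d + 1, L, m, K, hd, hL⟩ : Params) j)) × Fin (d + 1)) =>
        (((wP (Mk (⟨d + 1, L, m, K, hd, hL⟩ : Params) j) (L ^ j) z b.1 * (if ν = lam then x ⟨(EK hj').symm b.1, b.2⟩ else 0) : ℝ) : ℂ))) = 0 := by
  have hL0 : 0 < L := Nat.pos_of_ne_zero (NeZero.ne L)
  have hn1 : 1 ≤ L ^ j := Nat.one_le_pow _ _ hL0
  funext ν b
  rw [Pi.zero_apply, Pi.zero_apply, Complex.ofReal_eq_zero]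
  by_cases hmem : b.1 ∈ cubeT (L ^ j) (Mk (⟨d + 1, L, m, K, hd, hL⟩ : Params) j) z
  · by_cases hν : ν = lam
    · rw [if_pos hν]
      by_cases hx0 : x ⟨(EK hj').symm b.1, b.2⟩ = 0
      · rw [hx0, mul_zero]
      · exfalso
        apply hz
        have h1 := hsupp _ hx0
        have h2 : b.1 ∈ cubeT (L ^ j) (Mk (⟨d + 1, L, m, K, hd, hL⟩ : Params) j) (iterBlockOf j ((EK hj').symm b.1)) := by
          have := EK_mem_cubeT_blk hj' ((EK hj').symm b.1)
          rwa [Equiv.apply_symm_apply] at this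
        have h3 : distSite (Mk (⟨d + 1, L, m, K, hd, hL⟩ : Params) j) z (iterBlockOf j ((EK hj').symm b.1)) ≤ 3 :=
          distSite_le_three_of_mem_mem hn1 hmem h2
        have h3' : torusSupNorm (Mk (⟨d + 1, L, m, K, hd, hL⟩ : Params) j) (rep (Mk (⟨d + 1, L, m, K, hd, hL⟩ : Params) j) z - rep (Mk (⟨d + 1, L, m, K, hd, hL⟩ : Params) j) (iterBlockOf j ((EK hj').symm b.1))) ≤ 3 := by
          rw [← supDist_cast_eq_torusSupNorm, supDist_cast_eq_distSite]; exact h3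
        have ht := (torusDist_isPseudoDist (Mk (⟨d + 1, L, m, K, hd, hL⟩ : Params) j)).triangle z (iterBlockOf j ((EK hj').symm b.1)) y'
        change torusSupNorm (Mk (⟨d + 1, L, m, K, hd, hL⟩ : Params) j) (rep (Mk (⟨d + 1, L, m, K, hd, hL⟩ : Params) j) z - rep (Mk (⟨d + 1, L, m, K, hd, hL⟩ : Params) j) y') ≤
          torusSupNorm (Mk (⟨d + 1, L, m, K, hd, hL⟩ : Params) j) (rep (Mk (⟨d + 1, L, m, K, hd, hL⟩ : Params) j) z - rep (Mk (⟨d + 1, L, m, K, hd, hL⟩ : Params) j) (iterBlockOf j ((EK hj').symm b.1))) +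
          torusSupNorm (Mk (⟨d + 1, L, m, K, hd, hL⟩ : Params) j) (rep (Mk (⟨d + 1, L, m, K, hd, hL⟩ : Params) j) (iterBlockOf j ((EK hj').symm b.1)) - rep (Mk (⟨d + 1, L, m, K, hd, hL⟩ : Params) j) y') at ht
        linarith
    · rw [if_neg hν, mul_zero]
  · rw [wP_eq_zero_of_not_mem (Mk (⟨d + 1, L, m, K, hd, hL⟩ : Params) j) (L ^ j) hn1 hmem, zero_mul]

/-! ## §5  The cube-sup bound of `∇_μG^{(w′)}∇_λ*` with Hölder input -/

omit [NeZero L] in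
/-- the ball count on the unit torus in the form used below: `Σ_{z : |z − y′| ≤ R} e^{−δ|y − z|} ≤ K(1)e^{(1+δ)R}·e^{−δ|y − y′|}` (`δ ≥ 0`).
[cite: Balaban1984PropagatorsI, (1.115) p.36 (lattice sums; ours)] -/
theorem sum_ball_exp_le (y y' : Site (⟨d + 1, L, m, K, hd, hL⟩ : Params) j) {R δ : ℝ} (hδ : 0 ≤ δ) :
    ∑ z ∈ univ.filter (fun z : Site (⟨d + 1, L, m, K, hd, hL⟩ : Params) j => torusSupNorm (Mk (⟨d + 1, L, m, K, hd, hL⟩ : Params) j) (rep (Mk (⟨d + 1, L, m, K, hd, hL⟩ : Params) j) z - rep (Mk (⟨d + 1, L, m, K, hd, hL⟩ : Params) j) y') ≤ R),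
        Real.exp (-(δ * torusSupNorm (Mk (⟨d + 1, L, m, K, hd, hL⟩ : Params) j) (rep (Mk (⟨d + 1, L, m, K, hd, hL⟩ : Params) j) y - rep (Mk (⟨d + 1, L, m, K, hd, hL⟩ : Params) j) z))) ≤
      latticeConst (d + 1) 1 * Real.exp ((1 + δ) * R) *
        Real.exp (-(δ * torusSupNorm (Mk (⟨d + 1, L, m, K, hd, hL⟩ : Params) j) (rep (Mk (⟨d + 1, L, m, K, hd, hL⟩ : Params) j) y - rep (Mk (⟨d + 1, L, m, K, hd, hL⟩ : Params) j) y'))) := by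
  have hρ := torusDist_isPseudoDist (Mk (⟨d + 1, L, m, K, hd, hL⟩ : Params) j)
  have hK := torusDist_sumBound (Mk (⟨d + 1, L, m, K, hd, hL⟩ : Params) j)
  have hball : ∀ z ∈ univ.filter (fun z : Site (⟨d + 1, L, m, K, hd, hL⟩ : Params) j => torusSupNorm (Mk (⟨d + 1, L, m, K, hd, hL⟩ : Params) j) (rep (Mk (⟨d + 1, L, m, K, hd, hL⟩ : Params) j) z - rep (Mk (⟨d + 1, L, m, K, hd, hL⟩ : Params) j) y') ≤ R),
      Real.exp (-(δ * torusSupNorm (Mk (⟨d + 1, L, m, K, hd, hL⟩ : Params) j) (rep (Mk (⟨d + 1, L, m, K, hd, hL⟩ : Params) j) y - rep (Mk (⟨d + 1, L, m, K, hd, hL⟩ : Params) j) z))) ≤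
        Real.exp (δ * R) * Real.exp (-(δ * torusSupNorm (Mk (⟨d + 1, L, m, K, hd, hL⟩ : Params) j) (rep (Mk (⟨d + 1, L, m, K, hd, hL⟩ : Params) j) y - rep (Mk (⟨d + 1, L, m, K, hd, hL⟩ : Params) j) y'))) := by
    intro z hz
    have hz' := (Finset.mem_filter.mp hz).2
    rw [← Real.exp_add]
    apply Real.exp_le_exp.mpr
    have t1 := hρ.triangle y z y'
    nlinarith [mul_le_mul_of_nonneg_left t1 hδ, mul_le_mul_of_nonneg_left hz' hδ]
  calc _ ≤ ∑ z ∈ univ.filter (fun z : Site (⟨d + 1, L, m, K, hd, hL⟩ : Params) j => torusSupNorm (Mk (⟨d + 1, L, m, K, hd, hL⟩ : Params) j) (rep (Mk (⟨d + 1, L, m, K, hd, hL⟩ : Params) j) z - rep (Mk (⟨d + 1, L, m, K, hd, hL⟩ : Params) j) y') ≤ R),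
        Real.exp (δ * R) * Real.exp (-(δ * torusSupNorm (Mk (⟨d + 1, L, m, K, hd, hL⟩ : Params) j) (rep (Mk (⟨d + 1, L, m, K, hd, hL⟩ : Params) j) y - rep (Mk (⟨d + 1, L, m, K, hd, hL⟩ : Params) j) y'))) :=
          Finset.sum_le_sum hball
    _ = ((univ.filter (fun z : Site (⟨d + 1, L, m, K, hd, hL⟩ : Params) j => torusSupNorm (Mk (⟨d + 1, L, m, K, hd, hL⟩ : Params) j) (rep (Mk (⟨d + 1, L, m, K, hd, hL⟩ : Params) j) z - rep (Mk (⟨d + 1, L, m, K, hd, hL⟩ : Params) j) y') ≤ R)).card : ℝ) *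
        (Real.exp (δ * R) * Real.exp (-(δ * torusSupNorm (Mk (⟨d + 1, L, m, K, hd, hL⟩ : Params) j) (rep (Mk (⟨d + 1, L, m, K, hd, hL⟩ : Params) j) y - rep (Mk (⟨d + 1, L, m, K, hd, hL⟩ : Params) j) y')))) := by
          rw [Finset.sum_const, nsmul_eq_mul]
    _ ≤ (Real.exp R * latticeConst (d + 1) 1) *
        (Real.exp (δ * R) * Real.exp (-(δ * torusSupNorm (Mk (⟨d + 1, L, m, K, hd, hL⟩ : Params) j) (rep (Mk (⟨d + 1, L, m, K, hd, hL⟩ : Params) j) y - rep (Mk (⟨d + 1, L, m, K, hd, hL⟩ : Params) j) y')))) :=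
          mul_le_mul_of_nonneg_right (card_ball_le hρ hK y' R) (by positivity)
    _ = _ := by
          have : Real.exp ((1 + δ) * R) = Real.exp R * Real.exp (δ * R) := by rw [← Real.exp_add]; ring_nf
          rw [this]; ring

include ha in
/-- **THE CUBE-SUP BOUND OF `∇_μG^{(w′)}∇_λ*` WITH HÖLDER INPUT**: if the member (1.112) holds on B5's carrier of scale `j` of this torus at
`(O(1)(ε), δ)` (§1), then for directions `λ, μ`, a fine bond field `x` supported over the unit sites within `r` of `y′` with `|x| ≤ X` and
`|x(b) − x(b′)| ≤ X_ε(|b₋ − b₋′|_∞/n)^ε` on same-direction pairs at `|b₋ − b₋′|_∞ ≤ n`, and every fine bond `b₀`: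
`|(∇_μG^{(w′)}∇_λ*x)(b₀)| ≤ O(1)(ε)·K(1)e^{(1+δ)(r+3)}·(c_P + 1)·e^{−δ|y(b₀₋) − y′|_T}·(X_ε + X)`, `c_P = max(1, Lw(d+1))` — §2, the pieces
`T = Σ_z ζ′_zT` (§4, r02), (1.112) for each piece at the centre `z` with `‖ζ′_zT‖_ε ≤ c_P(‖T‖_ε + |T|)` (r02's `piece_holder`), §3, and the ball
count `sum_ball_exp_le`. [cite: Balaban1984PropagatorsI, Prop. 1.2 (1.112) p.36, (1.116) p.36; Balaban1984PropagatorsII, p.246 («They follow from the Proposition 1.2»)] -/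
theorem abs_DGEDadj_apply_le {Cε δ ε : ℝ} (hC0 : 0 ≤ Cε) (hδ : 0 ≤ δ) (hε0 : 0 < ε) (hε1 : ε < 1)
    (H : ∀ (T : LocR (((⟨d + 1, L, m, K, hd, hL⟩ : Params).L) ^ j) (Mk (⟨d + 1, L, m, K, hd, hL⟩ : Params) j))
      (y y' : Tor (Mk (⟨d + 1, L, m, K, hd, hL⟩ : Params) j)),
      suppInL (((⟨d + 1, L, m, K, hd, hL⟩ : Params).L) ^ j) (Mk (⟨d + 1, L, m, K, hd, hL⟩ : Params) j) T.emb y' →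
      e4L (((⟨d + 1, L, m, K, hd, hL⟩ : Params).L) ^ j) (Mk (⟨d + 1, L, m, K, hd, hL⟩ : Params) j) a T.emb y ≤
        Cε * Real.exp (-(δ * distSite (Mk (⟨d + 1, L, m, K, hd, hL⟩ : Params) j) y y')) *
          (holderL (((⟨d + 1, L, m, K, hd, hL⟩ : Params).L) ^ j) (Mk (⟨d + 1, L, m, K, hd, hL⟩ : Params) j) ε T.emb +
            supNormL (((⟨d + 1, L, m, K, hd, hL⟩ : Params).L) ^ j) (Mk (⟨d + 1, L, m, K, hd, hL⟩ : Params) j) T.emb))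
    (lam mu : Fin (d + 1)) (x : BondSpace (⟨d + 1, L, m, K, hd, hL⟩ : Params)) {X Xε r : ℝ} (hX : 0 ≤ X) (hXε : 0 ≤ Xε)
    (y' : Site (⟨d + 1, L, m, K, hd, hL⟩ : Params) j)
    (hsupp : ∀ b : PBond (⟨d + 1, L, m, K, hd, hL⟩ : Params) 0, x b ≠ 0 →
      torusSupNorm (Mk (⟨d + 1, L, m, K, hd, hL⟩ : Params) j) (rep (Mk (⟨d + 1, L, m, K, hd, hL⟩ : Params) j) (iterBlockOf j b.src) - rep (Mk (⟨d + 1, L, m, K, hd, hL⟩ : Params) j) y') ≤ r)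
    (hx : ∀ b : PBond (⟨d + 1, L, m, K, hd, hL⟩ : Params) 0, |x b| ≤ X)
    (hH : ∀ b b' : PBond (⟨d + 1, L, m, K, hd, hL⟩ : Params) 0, b.dir = b'.dir → supDist b.src b'.src ≤ L ^ j →
      |x b - x b'| ≤ Xε * (((supDist b.src b'.src : ℕ) : ℝ) / (L : ℝ) ^ j) ^ ε)
    (b₀ : PBond (⟨d + 1, L, m, K, hd, hL⟩ : Params) 0) :
    |(((((L : ℝ) ^ j) • (onE (LinearMap.funLeft ℝ ℝ (fun b : PBond (⟨d + 1, L, m, K, hd, hL⟩ : Params) 0 => (⟨b.src.shift mu, b.dir⟩ : PBond (⟨d + 1, L, m, K, hd, hL⟩ : Params) 0))) - LinearMap.id) : BondSpace (⟨d + 1, L, m, K, hd, hL⟩ : Params) →ₗ[ℝ] BondSpace (⟨d + 1, L, m, K, hd, hL⟩ : Params))) ∘ₗ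
      (GE (Domains.whole (P := (⟨d + 1, L, m, K, hd, hL⟩ : Params)) j hj') hc (w := fun _ => a * ((L : ℝ) ^ j) ^ (d + 1)) (fun _ => hw') ∘ₗ ((((L : ℝ) ^ j) • (onE (LinearMap.funLeft ℝ ℝ (fun b : PBond (⟨d + 1, L, m, K, hd, hL⟩ : Params) 0 => (⟨b.src.unshift lam, b.dir⟩ : PBond (⟨d + 1, L, m, K, hd, hL⟩ : Params) 0))) - LinearMap.id) : BondSpace (⟨d + 1, L, m, K, hd, hL⟩ : Params) →ₗ[ℝ] BondSpace (⟨d + 1, L, m, K, hd, hL⟩ : Params))))) x b₀| ≤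
      Cε * (latticeConst (d + 1) 1 * Real.exp ((1 + δ) * (r + 3))) * (max 1 (Lw (d + 1)) + 1) *
        Real.exp (-(δ * torusSupNorm (Mk (⟨d + 1, L, m, K, hd, hL⟩ : Params) j) (rep (Mk (⟨d + 1, L, m, K, hd, hL⟩ : Params) j) (iterBlockOf j b₀.src) - rep (Mk (⟨d + 1, L, m, K, hd, hL⟩ : Params) j) y'))) * (Xε + X) := by
  classical
  have hL0 : 0 < L := Nat.pos_of_ne_zero (NeZero.ne L)
  have hn1 : 1 ≤ L ^ j := Nat.one_le_pow _ _ hL0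
  have hM2 : ∀ μ, 2 ≤ Mk (⟨d + 1, L, m, K, hd, hL⟩ : Params) j μ := two_le_Mk (⟨d + 1, L, m, K, hd, hL⟩ : Params) j
  -- abbreviations: the fine torus of scale `j`, the source, the field map
  set M : Fin (d + 1) → ℕ := Mk (⟨d + 1, L, m, K, hd, hL⟩ : Params) j with hMdef
  set Tc : Fin (d + 1) → (Tor (fine (L ^ j) M) × Fin (d + 1) → ℂ) := fun ν b => ((if ν = lam then x ⟨(EK hj').symm b.1, b.2⟩ else 0 : ℝ) : ℂ) with hTc
  obtain ⟨T, hT⟩ : ∃ T : LocR (L ^ j) M, T = LocR.ten (fun ν b => if ν = lam then x ⟨(EK hj').symm b.1, b.2⟩ else 0) := ⟨_, rfl⟩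
  have hTemb : T.emb = Loc189.ten Tc := by rw [hT]; rfl
  set fld : (Fin (d + 1) → (Tor (fine (L ^ j) M) × Fin (d + 1) → ℂ)) → Fin (d + 1) → (Tor (fine (L ^ j) M) × Fin (d + 1) → ℂ) :=
    fun T' => B5Prop11Lattice.grad (L ^ j) M ((DeltaA (L ^ j) M a)⁻¹ *ᵥ divT (L ^ j) M T') with hfld
  set p₀ : Fin (d + 1) × (Tor (fine (L ^ j) M) × Fin (d + 1)) := (mu, (EK hj' b₀.src, b₀.dir)) with hp₀
  -- §2: the value is `Re (fld Tc) p₀`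
  have hval : (((((L : ℝ) ^ j) • (onE (LinearMap.funLeft ℝ ℝ (fun b : PBond (⟨d + 1, L, m, K, hd, hL⟩ : Params) 0 => (⟨b.src.shift mu, b.dir⟩ : PBond (⟨d + 1, L, m, K, hd, hL⟩ : Params) 0))) - LinearMap.id) : BondSpace (⟨d + 1, L, m, K, hd, hL⟩ : Params) →ₗ[ℝ] BondSpace (⟨d + 1, L, m, K, hd, hL⟩ : Params))) ∘ₗ
      (GE (Domains.whole (P := (⟨d + 1, L, m, K, hd, hL⟩ : Params)) j hj') hc (w := fun _ => a * ((L : ℝ) ^ j) ^ (d + 1)) (fun _ => hw') ∘ₗ ((((L : ℝ) ^ j) • (onE (LinearMap.funLeft ℝ ℝ (fun b : PBond (⟨d + 1, L, m, K, hd, hL⟩ : Params) 0 => (⟨b.src.unshift lam, b.dir⟩ : PBond (⟨d + 1, L, m, K, hd, hL⟩ : Params) 0))) - LinearMap.id) : BondSpace (⟨d + 1, L, m, K, hd, hL⟩ : Params) →ₗ[ℝ] BondSpace (⟨d + 1, L, m, K, hd, hL⟩ : Params))))) x b₀ =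
      (fld Tc p₀.1 p₀.2).re := by
    rw [DGEDadj_apply_eq hj' hc ha hw']
  -- §4: the pieces and the linearity of `fld`
  have hfld_add : ∀ (s : Finset (Site (⟨d + 1, L, m, K, hd, hL⟩ : Params) j)) (Tz : Site (⟨d + 1, L, m, K, hd, hL⟩ : Params) j → Fin (d + 1) → (Tor (fine (L ^ j) M) × Fin (d + 1) → ℂ)),
      fld (∑ z ∈ s, Tz z) = ∑ z ∈ s, fld (Tz z) := by
    intro s Tz
    simp only [hfld]
    rw [divT_sum, mulVec_finset_sum', grad_sum]
  have hdecomp : Tc = ∑ z : Site (⟨d + 1, L, m, K, hd, hL⟩ : Params) j, smulT (L ^ j) M (wP M (L ^ j) z) Tc :=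
    (sum_pieces_ten M (L ^ j) hM2 Tc).symm
  have hpiece : ∀ z : Site (⟨d + 1, L, m, K, hd, hL⟩ : Params) j, smulT (L ^ j) M (wP M (L ^ j) z) Tc =
      fun ν b => (((wP M (L ^ j) z b.1 * (if ν = lam then x ⟨(EK hj').symm b.1, b.2⟩ else 0) : ℝ) : ℂ)) := by
    intro z; funext ν b; simp only [smulT, hTc, Complex.ofReal_mul]
  -- the value as a sum over the pieces
  have hsum : fld Tc p₀.1 p₀.2 = ∑ z : Site (⟨d + 1, L, m, K, hd, hL⟩ : Params) j, fld (smulT (L ^ j) M (wP M (L ^ j) z) Tc) p₀.1 p₀.2 := by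
    conv_lhs => rw [hdecomp]
    rw [hfld_add, Finset.sum_apply, Finset.sum_apply]
  -- the real piece sources and their (1.112) bounds
  have hz_bound : ∀ z : Site (⟨d + 1, L, m, K, hd, hL⟩ : Params) j,
      ‖fld (smulT (L ^ j) M (wP M (L ^ j) z) Tc) p₀.1 p₀.2‖ ≤
        Cε * Real.exp (-(δ * torusSupNorm M (rep M (iterBlockOf j b₀.src) - rep M z))) * ((max 1 (Lw (d + 1)) + 1) * (Xε + X)) := by
    intro z
    obtain ⟨Tz, hTz⟩ : ∃ Tz : LocR (L ^ j) M, Tz = LocR.ten (fun ν b => wP M (L ^ j) z b.1 * (if ν = lam then x ⟨(EK hj').symm b.1, b.2⟩ else 0)) := ⟨_, rfl⟩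
    have hTz_emb : Tz.emb = pieceL M (L ^ j) z T.emb := by rw [hTz, hT, pieceL_srcT_eq hj']
    have hTz_ten : Tz.emb = Loc189.ten (smulT (L ^ j) M (wP M (L ^ j) z) Tc) := by rw [hTz, hpiece z]; rfl
    -- the value below the cube sup `e4L` of the piece at the block of `b₀`
    have hmem : p₀ ∈ Finset.univ ×ˢ cubeB (L ^ j) M (iterBlockOf j b₀.src) :=
      Finset.mem_product.mpr ⟨Finset.mem_univ _, Finset.mem_product.mpr ⟨EK_mem_cubeT_blk hj' b₀.src, Finset.mem_univ _⟩⟩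
    have h1 : ‖fld (smulT (L ^ j) M (wP M (L ^ j) z) Tc) p₀.1 p₀.2‖ ≤ e4L (L ^ j) M a Tz.emb (iterBlockOf j b₀.src) := by
      rw [hTz_ten, B5Prop12FieldsLattice.e4L_ten]
      exact norm_le_supNorm (f := fun p : Fin (d + 1) × (Tor (fine (L ^ j) M) × Fin (d + 1)) => fld (smulT (L ^ j) M (wP M (L ^ j) z) Tc) p.1 p.2) hmem
    -- (1.112) for the piece at the centre `z`
    have h2 := H Tz (iterBlockOf j b₀.src) z (by rw [hTz_emb]; exact piece_supp M (L ^ j) z T.emb)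
    -- the sizes of the piece
    have h3 : holderL (L ^ j) M ε Tz.emb ≤ max 1 (Lw (d + 1)) * (holderL (L ^ j) M ε T.emb + supNormL (L ^ j) M T.emb) := by
      rw [hTz_emb]; exact piece_holder M (L ^ j) hM2 ε T.emb z hε0 hε1
    have h4 : supNormL (L ^ j) M Tz.emb ≤ supNormL (L ^ j) M T.emb := by rw [hTz_emb]; exact piece_sup M (L ^ j) z T.emb
    have h5 : holderL (L ^ j) M ε T.emb ≤ Xε := by rw [hT]; exact holderL_srcT_le hj' lam x hXε hH
    have h6 : supNormL (L ^ j) M T.emb ≤ X := by rw [hT]; exact supNormL_srcT_le hj' lam x hX hx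
    have h7 : holderL (L ^ j) M ε Tz.emb + supNormL (L ^ j) M Tz.emb ≤ (max 1 (Lw (d + 1)) + 1) * (Xε + X) := by
      have hm1 : (1 : ℝ) ≤ max 1 (Lw (d + 1)) := le_max_left _ _
      have hHo : 0 ≤ holderL (L ^ j) M ε T.emb := B5Prop12FieldsLattice.holderL_nonneg _ _
      have hSo : 0 ≤ supNormL (L ^ j) M T.emb := B5Prop12FieldsLattice.supNormL_nonneg _
      nlinarith
    have hdist : distSite M (iterBlockOf j b₀.src) z = torusSupNorm M (rep M (iterBlockOf j b₀.src) - rep M z) := by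
      rw [← supDist_cast_eq_distSite, supDist_cast_eq_torusSupNorm]
    rw [hdist] at h2
    have hCE : 0 ≤ Cε * Real.exp (-(δ * torusSupNorm M (rep M (iterBlockOf j b₀.src) - rep M z))) := mul_nonneg hC0 (Real.exp_pos _).le
    exact h1.trans (h2.trans (mul_le_mul_of_nonneg_left h7 hCE))
  -- far pieces vanish
  have hz_far : ∀ z : Site (⟨d + 1, L, m, K, hd, hL⟩ : Params) j, ¬ torusSupNorm M (rep M z - rep M y') ≤ r + 3 →
      ‖fld (smulT (L ^ j) M (wP M (L ^ j) z) Tc) p₀.1 p₀.2‖ = 0 := by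
    intro z hz
    rw [hpiece z, srcPiece_eq_zero_of_far hj' lam x y' hsupp z hz]
    simp only [hfld]
    rw [grad_G_divT_zero]
    simp
  -- assemble
  have hρ := torusDist_isPseudoDist M
  rw [hval]
  calc |(fld Tc p₀.1 p₀.2).re| ≤ ‖fld Tc p₀.1 p₀.2‖ := Complex.abs_re_le_norm _
    _ = ‖∑ z : Site (⟨d + 1, L, m, K, hd, hL⟩ : Params) j, fld (smulT (L ^ j) M (wP M (L ^ j) z) Tc) p₀.1 p₀.2‖ := by rw [hsum]
    _ ≤ ∑ z : Site (⟨d + 1, L, m, K, hd, hL⟩ : Params) j, ‖fld (smulT (L ^ j) M (wP M (L ^ j) z) Tc) p₀.1 p₀.2‖ := norm_sum_le _ _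
    _ = ∑ z ∈ univ.filter (fun z : Site (⟨d + 1, L, m, K, hd, hL⟩ : Params) j => torusSupNorm M (rep M z - rep M y') ≤ r + 3),
          ‖fld (smulT (L ^ j) M (wP M (L ^ j) z) Tc) p₀.1 p₀.2‖ := by
        rw [← Finset.sum_filter_add_sum_filter_not univ (fun z : Site (⟨d + 1, L, m, K, hd, hL⟩ : Params) j => torusSupNorm M (rep M z - rep M y') ≤ r + 3)]
        rw [Finset.sum_eq_zero (s := univ.filter (fun z : Site (⟨d + 1, L, m, K, hd, hL⟩ : Params) j => ¬ torusSupNorm M (rep M z - rep M y') ≤ r + 3))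
          (fun z hz => hz_far z (Finset.mem_filter.mp hz).2), add_zero]
    _ ≤ ∑ z ∈ univ.filter (fun z : Site (⟨d + 1, L, m, K, hd, hL⟩ : Params) j => torusSupNorm M (rep M z - rep M y') ≤ r + 3),
          Cε * Real.exp (-(δ * torusSupNorm M (rep M (iterBlockOf j b₀.src) - rep M z))) * ((max 1 (Lw (d + 1)) + 1) * (Xε + X)) :=
        Finset.sum_le_sum fun z _ => hz_bound z
    _ = Cε * ((max 1 (Lw (d + 1)) + 1) * (Xε + X)) *
          ∑ z ∈ univ.filter (fun z : Site (⟨d + 1, L, m, K, hd, hL⟩ : Params) j => torusSupNorm M (rep M z - rep M y') ≤ r + 3),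
            Real.exp (-(δ * torusSupNorm M (rep M (iterBlockOf j b₀.src) - rep M z))) := by
        rw [Finset.mul_sum]
        exact Finset.sum_congr rfl fun z _ => by ring
    _ ≤ Cε * ((max 1 (Lw (d + 1)) + 1) * (Xε + X)) *
          (latticeConst (d + 1) 1 * Real.exp ((1 + δ) * (r + 3)) * Real.exp (-(δ * torusSupNorm M (rep M (iterBlockOf j b₀.src) - rep M y')))) := by
        have hLw := Lw_nonneg (d + 1)
        exact mul_le_mul_of_nonneg_left (sum_ball_exp_le (hd := hd) (hL := hL) (iterBlockOf j b₀.src) y' hδ) (by positivity)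
    _ = _ := by ring

end Transport

/-! ## §6  Uniform constants: all volumes, all scales -/

variable {d L m K : ℕ} {hd : 1 ≤ d + 1} {hL : Odd L ∧ 1 < L} {j : ℕ}

open Classical in
/-- **[4] PROPOSITION 1.2, THE MEMBER (1.112), FOR `∇_μG^{(w′)}∇_λ*` AS A CUBE-SUP BOUND WITH HÖLDER INPUT, UNIFORMLY** (`c = L^j`, `w′ = a·n^{d+1}`):
there is `δ₀ > 0` depending on `d, L, a` only and, for every rate `0 < δ ≤ δ₀` and every `0 < ε < 1`, a `C_ε ≥ 0` such that for every volume `(m, K)`, every `j ≤ m + K`, all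
directions `λ, μ`, every radius `r`, every unit site `y′`, every fine bond field `x` supported over the unit sites within `r` of `y′` with
`|x| ≤ X` and `|x(b) − x(b′)| ≤ X_ε(|b₋ − b₋′|_∞/L^j)^ε` on same-direction pairs at `|b₋ − b₋′|_∞ ≤ L^j`, and every fine bond `b₀`:
`|(∇_μG^{(w′)}∇_λ*x)(b₀)| ≤ C_ε·e^{(1+δ)(r+3)}·e^{−δ|y(b₀₋) − y′|_T}·(X_ε + X)` (§1 transported by §5).
[cite: Balaban1984PropagatorsI, Prop. 1.2 (1.112) p.36; Balaban1984PropagatorsII, Prop. 2.5 p.246 («They follow from the Proposition 1.2»)] -/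
theorem cubeSup112_DGEDadj_scaling (d L : ℕ) (hd : 1 ≤ d + 1) (hL : Odd L ∧ 1 < L) {a : ℝ} (ha : 0 < a) :
    ∃ δ₀ : ℝ, 0 < δ₀ ∧ ∀ δ : ℝ, 0 < δ → δ ≤ δ₀ → ∀ ε : ℝ, 0 < ε → ε < 1 → ∃ C : ℝ, 0 ≤ C ∧ ∀ (m K j : ℕ)
      (hj' : j ≤ (⟨d + 1, L, m, K, hd, hL⟩ : Params).m + (⟨d + 1, L, m, K, hd, hL⟩ : Params).K) (hc : ((L : ℝ) ^ j) ≠ 0)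
      (hw' : (0 : ℝ) < a * ((L : ℝ) ^ j) ^ (d + 1)) (lam mu : Fin (d + 1))
      (x : BondSpace (⟨d + 1, L, m, K, hd, hL⟩ : Params)) (X Xε r : ℝ) (_ : 0 ≤ X) (_ : 0 ≤ Xε)
      (y' : Site (⟨d + 1, L, m, K, hd, hL⟩ : Params) j)
      (_ : ∀ b : PBond (⟨d + 1, L, m, K, hd, hL⟩ : Params) 0, x b ≠ 0 →
        torusSupNorm (Mk (⟨d + 1, L, m, K, hd, hL⟩ : Params) j) (rep (Mk (⟨d + 1, L, m, K, hd, hL⟩ : Params) j) (iterBlockOf j b.src) - rep (Mk (⟨d + 1, L, m, K, hd, hL⟩ : Params) j) y') ≤ r)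
      (_ : ∀ b : PBond (⟨d + 1, L, m, K, hd, hL⟩ : Params) 0, |x b| ≤ X)
      (_ : ∀ b b' : PBond (⟨d + 1, L, m, K, hd, hL⟩ : Params) 0, b.dir = b'.dir → supDist b.src b'.src ≤ L ^ j →
        |x b - x b'| ≤ Xε * (((supDist b.src b'.src : ℕ) : ℝ) / (L : ℝ) ^ j) ^ ε)
      (b₀ : PBond (⟨d + 1, L, m, K, hd, hL⟩ : Params) 0),
      |(((((L : ℝ) ^ j) • (onE (LinearMap.funLeft ℝ ℝ (fun b : PBond (⟨d + 1, L, m, K, hd, hL⟩ : Params) 0 => (⟨b.src.shift mu, b.dir⟩ : PBond (⟨d + 1, L, m, K, hd, hL⟩ : Params) 0))) - LinearMap.id) : BondSpace (⟨d + 1, L, m, K, hd, hL⟩ : Params) →ₗ[ℝ] BondSpace (⟨d + 1, L, m, K, hd, hL⟩ : Params))) ∘ₗ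
        (GE (Domains.whole (P := (⟨d + 1, L, m, K, hd, hL⟩ : Params)) j hj') hc (w := fun _ => a * ((L : ℝ) ^ j) ^ (d + 1)) (fun _ => hw') ∘ₗ ((((L : ℝ) ^ j) • (onE (LinearMap.funLeft ℝ ℝ (fun b : PBond (⟨d + 1, L, m, K, hd, hL⟩ : Params) 0 => (⟨b.src.unshift lam, b.dir⟩ : PBond (⟨d + 1, L, m, K, hd, hL⟩ : Params) 0))) - LinearMap.id) : BondSpace (⟨d + 1, L, m, K, hd, hL⟩ : Params) →ₗ[ℝ] BondSpace (⟨d + 1, L, m, K, hd, hL⟩ : Params))))) x b₀| ≤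
        C * Real.exp ((1 + δ) * (r + 3)) *
          Real.exp (-(δ * torusSupNorm (Mk (⟨d + 1, L, m, K, hd, hL⟩ : Params) j) (rep (Mk (⟨d + 1, L, m, K, hd, hL⟩ : Params) j) (iterBlockOf j b₀.src) - rep (Mk (⟨d + 1, L, m, K, hd, hL⟩ : Params) j) y'))) * (Xε + X) := by
  obtain ⟨δ₀, hδ₀, Cε, hCε, H⟩ := e4L_allScales (d + 1) L ha
  refine ⟨δ₀, hδ₀, fun δ hδ hδδ₀ ε hε0 hε1 => ⟨Cε ε * latticeConst (d + 1) 1 * (max 1 (Lw (d + 1)) + 1), ?_, ?_⟩⟩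
  · have := hCε ε
    have := Lw_nonneg (d + 1)
    have := latticeConst_nonneg (d + 1) (zero_le_one : (0:ℝ) ≤ 1)
    positivity
  intro m K j hj' hc hw' lam mu x X Xε r hX hXε y' hsupp hx hH b₀
  haveI : NeZero L := ⟨by have := hL.2; omega⟩
  -- the member at the rate `δ₀` implies the member at any smaller rate `δ`
  have H' : ∀ (T : LocR (((⟨d + 1, L, m, K, hd, hL⟩ : Params).L) ^ j) (Mk (⟨d + 1, L, m, K, hd, hL⟩ : Params) j))
      (y y' : Tor (Mk (⟨d + 1, L, m, K, hd, hL⟩ : Params) j)),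
      suppInL (((⟨d + 1, L, m, K, hd, hL⟩ : Params).L) ^ j) (Mk (⟨d + 1, L, m, K, hd, hL⟩ : Params) j) T.emb y' →
      e4L (((⟨d + 1, L, m, K, hd, hL⟩ : Params).L) ^ j) (Mk (⟨d + 1, L, m, K, hd, hL⟩ : Params) j) a T.emb y ≤
        Cε ε * Real.exp (-(δ * distSite (Mk (⟨d + 1, L, m, K, hd, hL⟩ : Params) j) y y')) *
          (holderL (((⟨d + 1, L, m, K, hd, hL⟩ : Params).L) ^ j) (Mk (⟨d + 1, L, m, K, hd, hL⟩ : Params) j) ε T.emb +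
            supNormL (((⟨d + 1, L, m, K, hd, hL⟩ : Params).L) ^ j) (Mk (⟨d + 1, L, m, K, hd, hL⟩ : Params) j) T.emb) := by
    intro T y y' hT
    refine (H (⟨d + 1, L, m, K, hd, hL⟩ : Params) rfl rfl j hj' ε hε0 hε1 T y y' hT).trans ?_
    have hD : 0 ≤ distSite (Mk (⟨d + 1, L, m, K, hd, hL⟩ : Params) j) y y' := B5Prop12FieldsLattice.distSite_nonneg _ _
    have hN : 0 ≤ holderL (((⟨d + 1, L, m, K, hd, hL⟩ : Params).L) ^ j) (Mk (⟨d + 1, L, m, K, hd, hL⟩ : Params) j) ε T.emb +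
        supNormL (((⟨d + 1, L, m, K, hd, hL⟩ : Params).L) ^ j) (Mk (⟨d + 1, L, m, K, hd, hL⟩ : Params) j) T.emb :=
      add_nonneg (B5Prop12FieldsLattice.holderL_nonneg _ _) (B5Prop12FieldsLattice.supNormL_nonneg _)
    have e1 : Real.exp (-(δ₀ * distSite (Mk (⟨d + 1, L, m, K, hd, hL⟩ : Params) j) y y')) ≤ Real.exp (-(δ * distSite (Mk (⟨d + 1, L, m, K, hd, hL⟩ : Params) j) y y')) :=
      Real.exp_le_exp.mpr (by nlinarith)
    exact mul_le_mul_of_nonneg_right (mul_le_mul_of_nonneg_left e1 (hCε ε)) hN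
  have h := abs_DGEDadj_apply_le hj' hc ha hw' (hCε ε) hδ.le hε0 hε1 H' lam mu x hX hXε y' hsupp hx hH b₀
  refine h.trans (le_of_eq ?_)
  ring

end Literature.MathematicalPhysics.QuantumFieldTheory.Balaban1983to89.B6Block112GEV1

end
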